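import Literature.Computability.AlgebraicComplexity.SymmetricArithCircuit
import Mathlib.Data.Fintype.Sum
import Mathlib.Data.Finset.BooleanAlgebra
import Mathlib.Logic.Embedding.Basic
import Mathlib.Logic.Equiv.Sum
import HarnessLib

/-!
# Symmetric circuits: folding an output family into one gate (orbit sums and orbit products)

Topic `Computability/AlgebraicComplexity`, namespace `Literature.Computability.AlgebraicComplexity`.

A closure property of Dawar–Wilsenach symmetric arithmetic circuits
(`SymmetricArithCircuit.lean`: `LabelledArithCircuit` = Def. 2.2, `IsAutomorphismExtending` =
Def. 3.6, `IsSymmetric` = Def. 3.7 of A. Dawar, G. Wilsenach, *Symmetric Arithmetic Circuits*,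
Theory of Computing 21 (2025)): if a `Γ`-symmetric labelled circuit `C` over constants `K` and
variables `X` computes the family `(g_y)_{y ∈ Y}` at outputs indexed by a finite nonempty `Γ`-set
`Y`, then the SUM `Σ_y g_y` (resp. the PRODUCT `Π_y g_y`) is computed by a `Γ`-symmetric
SINGLE-output circuit with exactly `|G| + 1` gates
(`LabelledArithCircuit.IsSymmetric.exists_sumOutputs`, `…exists_prodOutputs`). Typical uses:
the trace `Σ_i M_ii`, the sum of all entries of an equivariant matrix family, the product over an
orbit.

Construction (`LabelledArithCircuit.Fold.foldCircuit C l hl`, a post-composition gadget): gate set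
`G ⊕ Unit`; the old gates `Sum.inl g` keep their children and labels; the one new gate
`Sum.inr ()` carries the internal label `l ∈ {+, ×}` (`hl : ¬ l.IsInput`) and has as children the
set of output gates `{Sum.inl (C.output y) : y ∈ Y}` (nonempty because `Y` is, as Def. 2.2 demands
of a `+`/`×` gate; the outputs are distinct gates, `output_injective`); it is the single output.
Semantics (`foldCircuit_eval_inl`, `foldCircuit_eval_output_add`, `foldCircuit_eval_output_mul`):
old values are unchanged and the new gate computes `Σ_y g_y` resp. `Π_y g_y`. Symmetry
(`foldCircuit_isAutomorphismExtending`): an automorphism `π` of `C` extending `γ` (Def. 3.6)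
extends as `π ⊕ id`; the children of the new gate are mapped onto themselves because
`π (C.output y) = C.output (γ • y)` permutes the output gates among themselves, and its label
`+`/`×` is fixed by `γ`. Size: `|G ⊕ Unit| = |G| + 1`.
Everything is folklore and proved; nothing here is a named fact.
-/

noncomputable section

namespace Literature.Computability.AlgebraicComplexity

open MvPolynomial

universe u v w z

namespace CircuitLabel

/-- An internal label (`+` or `×`) is fixed by the action of any group on the variables
(Dawar–Wilsenach Def. 3.6, fourth bullet). [cite: DawarWilsenach2025, Def. 3.6] -/
theorem smul_eq_self_of_not_isInput {K : Type u} {X : Type v} {Γ : Type*} [Group Γ]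
    [MulAction Γ X] {l : CircuitLabel K X} (hl : ¬ l.IsInput) (γ : Γ) : γ • l = l := by
  cases l with
  | var x => exact absurd trivial hl
  | const c => exact absurd trivial hl
  | add => rfl
  | mul => rfl

end CircuitLabel

namespace LabelledArithCircuit

namespace Fold

variable {K : Type u} {X : Type v} {Y : Type z} {G : Type w}
  (C : LabelledArithCircuit K X Y G) (l : CircuitLabel K X)

/-! ### The construction -/

/-- The output gates of `C`, as an embedding of `Y` into the new gate set `G ⊕ Unit`
(`y ↦ Sum.inl (C.output y)`; injective by `output_injective`).
[cite: DawarWilsenach2025, Def. 2.2] -/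
def outEmb : Y ↪ G ⊕ Unit :=
  ⟨fun y => Sum.inl (C.output y), Sum.inl_injective.comp C.output_injective⟩

/-- `outEmb C y = Sum.inl (C.output y)`. [cite: DawarWilsenach2025, Def. 2.2] -/
@[simp] theorem outEmb_apply (y : Y) : outEmb C y = Sum.inl (C.output y) := rfl

/-- Labels in the folded circuit: old labels, and `l` (`+` or `×`) on the new gate.
[cite: DawarWilsenach2025, Def. 2.2] -/
def foldLabel : G ⊕ Unit → CircuitLabel K X
  | .inl g => C.label g
  | .inr _ => l

variable {l} in
/-- Labels are injective on input gates (only old gates are input gates).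
[cite: DawarWilsenach2025, Def. 2.2] -/
theorem eq_of_foldLabel_eq (hl : ¬ l.IsInput) (s t : G ⊕ Unit) (hs : (foldLabel C l s).IsInput)
    (hst : foldLabel C l s = foldLabel C l t) : s = t := by
  cases s with
  | inl g =>
    change (C.label g).IsInput at hs
    cases t with
    | inl g' => exact congrArg Sum.inl (C.eq_of_label_eq g g' hs hst)
    | inr u =>
      change C.label g = l at hst
      rw [hst] at hs
      exact absurd hs hl
  | inr u => exact absurd hs hl

variable [Fintype Y]

/-- Children in the folded circuit: an old gate keeps its children, the new gate `Sum.inr ()` has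
the output gates of `C` as children. [cite: DawarWilsenach2025, Def. 2.2] -/
def foldChildren : G ⊕ Unit → Finset (G ⊕ Unit)
  | .inl g => (C.children g).map Function.Embedding.inl
  | .inr _ => Finset.univ.map (outEmb C)

/-! #### Acyclicity -/

/-- Old gates are accessible (acyclicity of `C`). [cite: DawarWilsenach2025, Def. 2.2] -/
theorem acc_foldChildren_inl (g : G) :
    Acc (fun s t : G ⊕ Unit => s ∈ foldChildren C t) (.inl g) := by
  induction g using C.wf.induction with
  | h g ih =>
    refine Acc.intro _ fun s hs => ?_
    simp only [foldChildren, Finset.mem_map, Function.Embedding.inl_apply] at hs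
    obtain ⟨h, hh, rfl⟩ := hs
    exact ih h hh

/-- The new gate is accessible (its children are old gates). [cite: DawarWilsenach2025, Def. 2.2] -/
theorem acc_foldChildren_inr (u : Unit) :
    Acc (fun s t : G ⊕ Unit => s ∈ foldChildren C t) (.inr u) := by
  refine Acc.intro _ fun s hs => ?_
  simp only [foldChildren, Finset.mem_map, Finset.mem_univ, true_and, outEmb_apply] at hs
  obtain ⟨y, rfl⟩ := hs
  exact acc_foldChildren_inl C (C.output y)

/-- The child relation of the folded circuit is well founded.
[cite: DawarWilsenach2025, Def. 2.2] -/
theorem foldChildren_wf : WellFounded fun s t : G ⊕ Unit => s ∈ foldChildren C t :=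
  ⟨fun s => match s with
    | .inl g => acc_foldChildren_inl C g
    | .inr u => acc_foldChildren_inr C u⟩

/-! #### The labelled circuit -/

variable {l}

/-- Input labels exactly at the gates without children (the new gate is internal and, `Y` being
nonempty, has children). [cite: DawarWilsenach2025, Def. 2.2] -/
theorem isInput_foldLabel_iff [Nonempty Y] (hl : ¬ l.IsInput) (s : G ⊕ Unit) :
    (foldLabel C l s).IsInput ↔ foldChildren C s = ∅ := by
  cases s with
  | inl g => simp only [foldLabel, foldChildren, Finset.map_eq_empty]; exact C.isInput_iff g
  | inr u =>
    simp only [foldLabel, foldChildren, Finset.map_eq_empty, Finset.univ_eq_empty_iff,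
      not_isEmpty_of_nonempty, iff_false]
    exact hl

variable (l)

/-- **The folded circuit** of `C` with internal label `l` (module docstring): on top of `C`, one
new gate labelled `l` (`+`: the sum, `×`: the product of the outputs of `C`) over the set of
output gates of `C`; it is the single output. [cite: DawarWilsenach2025, Def. 2.2] -/
def foldCircuit [Nonempty Y] (hl : ¬ l.IsInput) : LabelledArithCircuit K X Unit (G ⊕ Unit) where
  children := foldChildren C
  label := foldLabel C l
  output := fun _ => Sum.inr ()
  wf := foldChildren_wf C
  isInput_iff := isInput_foldLabel_iff C hl
  eq_of_label_eq := eq_of_foldLabel_eq C hl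
  output_injective := fun s t _ => Subsingleton.elim s t

variable {C l} [Nonempty Y] {hl : ¬ l.IsInput}

/-! ### Semantics -/

section Eval

variable [CommSemiring K]

/-- Old gates keep their values. [cite: DawarWilsenach2025, §2 (evaluation)] -/
theorem foldCircuit_eval_inl (g : G) : (foldCircuit C l hl).eval (.inl g) = C.eval g := by
  induction g using C.wf.induction with
  | h g ih =>
    have hlab : (foldCircuit C l hl).label (.inl g) = C.label g := rfl
    have hch : (foldCircuit C l hl).children (.inl g) =
        (C.children g).map Function.Embedding.inl := rfl
    rcases hg : C.label g with x | c | _ | _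
    · rw [C.eval_of_label_var hg, (foldCircuit C l hl).eval_of_label_var (hlab.trans hg)]
    · rw [C.eval_of_label_const hg, (foldCircuit C l hl).eval_of_label_const (hlab.trans hg)]
    · rw [C.eval_of_label_add hg, (foldCircuit C l hl).eval_of_label_add (hlab.trans hg), hch,
        Finset.sum_map]
      exact Finset.sum_congr rfl fun h hh => ih h hh
    · rw [C.eval_of_label_mul hg, (foldCircuit C l hl).eval_of_label_mul (hlab.trans hg), hch,
        Finset.prod_map]
      exact Finset.prod_congr rfl fun h hh => ih h hh

/-- **Semantics, sum.** With the label `+` the output computes `Σ_y` of the outputs of `C`.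
[cite: DawarWilsenach2025, §2 (evaluation)] -/
theorem foldCircuit_eval_output_add :
    (foldCircuit C .add CircuitLabel.not_isInput_add).eval
        ((foldCircuit C .add CircuitLabel.not_isInput_add).output ()) =
      ∑ y, C.eval (C.output y) := by
  change (foldCircuit C .add CircuitLabel.not_isInput_add).eval (.inr ()) = _
  rw [(foldCircuit C .add _).eval_of_label_add
    (show (foldCircuit C .add CircuitLabel.not_isInput_add).label (.inr ()) = .add from rfl)]
  change ∑ h ∈ Finset.univ.map (outEmb C),
    (foldCircuit C .add CircuitLabel.not_isInput_add).eval h = _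
  rw [Finset.sum_map]
  exact Finset.sum_congr rfl fun y _ => foldCircuit_eval_inl (C.output y)

/-- **Semantics, product.** With the label `×` the output computes `Π_y` of the outputs of `C`.
[cite: DawarWilsenach2025, §2 (evaluation)] -/
theorem foldCircuit_eval_output_mul :
    (foldCircuit C .mul CircuitLabel.not_isInput_mul).eval
        ((foldCircuit C .mul CircuitLabel.not_isInput_mul).output ()) =
      ∏ y, C.eval (C.output y) := by
  change (foldCircuit C .mul CircuitLabel.not_isInput_mul).eval (.inr ()) = _
  rw [(foldCircuit C .mul _).eval_of_label_mul
    (show (foldCircuit C .mul CircuitLabel.not_isInput_mul).label (.inr ()) = .mul from rfl)]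
  change ∏ h ∈ Finset.univ.map (outEmb C),
    (foldCircuit C .mul CircuitLabel.not_isInput_mul).eval h = _
  rw [Finset.prod_map]
  exact Finset.prod_congr rfl fun y _ => foldCircuit_eval_inl (C.output y)

end Eval

/-! ### Symmetry -/

section Symmetry

variable {Γ : Type*} [Group Γ] [MulAction Γ X] [MulAction Γ Y] [MulAction Γ Unit] {γ : Γ}
  {π : Equiv.Perm G}

/-- **Symmetry.** If `π` is an automorphism of `C` extending `γ` then `π ⊕ id` is an automorphism
of the folded circuit extending `γ`: the output gates of `C` — the children of the new gate — are
permuted among themselves (`C.output (γ • y) = π (C.output y)`), and the label `+`/`×` of the new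
gate is fixed. [cite: DawarWilsenach2025, Def. 3.6] -/
theorem foldCircuit_isAutomorphismExtending (hπ : C.IsAutomorphismExtending γ π) :
    (foldCircuit C l hl).IsAutomorphismExtending γ (Equiv.sumCongr π (Equiv.refl Unit)) := by
  refine ⟨?_, ?_, fun _ => rfl⟩
  · rintro (g | u)
    · change (C.children (π g)).map Function.Embedding.inl =
        ((C.children g).map Function.Embedding.inl).map
          (Equiv.sumCongr π (Equiv.refl Unit)).toEmbedding
      rw [hπ.children_apply, Finset.map_map, Finset.map_map]
      rfl
    · change Finset.univ.map (outEmb C) =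
        (Finset.univ.map (outEmb C)).map (Equiv.sumCongr π (Equiv.refl Unit)).toEmbedding
      have key : (outEmb C).trans (Equiv.sumCongr π (Equiv.refl Unit)).toEmbedding =
          (MulAction.toPerm γ : Equiv.Perm Y).toEmbedding.trans (outEmb C) := by
        ext y : 1
        change Sum.inl (π (C.output y)) = Sum.inl (C.output (γ • y))
        rw [hπ.output_smul]
      rw [Finset.map_map, key, ← Finset.map_map, Finset.map_univ_equiv]
  · rintro (g | u)
    · exact hπ.label_apply g
    · change l = γ • l
      exact (CircuitLabel.smul_eq_self_of_not_isInput hl γ).symm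

/-- A `Γ`-symmetric `C` gives a `Γ`-symmetric folded circuit (Def. 3.7).
[cite: DawarWilsenach2025, Def. 3.7] -/
theorem foldCircuit_isSymmetric (hC : C.IsSymmetric Γ) : (foldCircuit C l hl).IsSymmetric Γ := by
  intro γ
  obtain ⟨π, hπ⟩ := hC γ
  exact ⟨Equiv.sumCongr π (Equiv.refl Unit), foldCircuit_isAutomorphismExtending hπ⟩

end Symmetry

end Fold

/-- **Orbit sums of symmetric circuits.** For any group `Γ` acting on the variables `X` and on a
finite nonempty output index set `Y`: if a `Γ`-symmetric labelled circuit `C` over `K`, `X`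
computes `(g_y)_{y ∈ Y}`, then `Σ_y g_y` is computed by a `Γ`-symmetric single-output labelled
circuit on at most `|G| + 1` gates (one new `+` gate over the output gates, `Fold.foldCircuit`;
Dawar–Wilsenach Defs. 2.2, 3.6, 3.7). [cite: DawarWilsenach2025, Def. 3.7] -/
theorem IsSymmetric.exists_sumOutputs {K : Type u} [CommSemiring K] {X : Type v} {Y : Type z}
    {Γ : Type*} [Group Γ] [MulAction Γ X] [MulAction Γ Y] [MulAction Γ Unit] [Fintype Y]
    [Nonempty Y] {G : Type w} [Fintype G] {C : LabelledArithCircuit K X Y G}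
    (hC : C.IsSymmetric Γ) :
    ∃ (G' : Type w) (_ : Fintype G') (C' : LabelledArithCircuit K X Unit G'),
      C'.IsSymmetric Γ ∧ C'.eval (C'.output ()) = ∑ y, C.eval (C.output y) ∧
        Fintype.card G' ≤ Fintype.card G + 1 :=
  ⟨G ⊕ Unit, inferInstance, Fold.foldCircuit C .add CircuitLabel.not_isInput_add,
    Fold.foldCircuit_isSymmetric hC, Fold.foldCircuit_eval_output_add,
    le_of_eq (by rw [Fintype.card_sum, Fintype.card_unit])⟩

/-- **Orbit products of symmetric circuits.** For any group `Γ` acting on the variables `X` and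
on a finite nonempty output index set `Y`: if a `Γ`-symmetric labelled circuit `C` over `K`, `X`
computes `(g_y)_{y ∈ Y}`, then `Π_y g_y` is computed by a `Γ`-symmetric single-output labelled
circuit on at most `|G| + 1` gates (one new `×` gate over the output gates, `Fold.foldCircuit`;
Dawar–Wilsenach Defs. 2.2, 3.6, 3.7). [cite: DawarWilsenach2025, Def. 3.7] -/
theorem IsSymmetric.exists_prodOutputs {K : Type u} [CommSemiring K] {X : Type v} {Y : Type z}
    {Γ : Type*} [Group Γ] [MulAction Γ X] [MulAction Γ Y] [MulAction Γ Unit] [Fintype Y]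
    [Nonempty Y] {G : Type w} [Fintype G] {C : LabelledArithCircuit K X Y G}
    (hC : C.IsSymmetric Γ) :
    ∃ (G' : Type w) (_ : Fintype G') (C' : LabelledArithCircuit K X Unit G'),
      C'.IsSymmetric Γ ∧ C'.eval (C'.output ()) = ∏ y, C.eval (C.output y) ∧
        Fintype.card G' ≤ Fintype.card G + 1 :=
  ⟨G ⊕ Unit, inferInstance, Fold.foldCircuit C .mul CircuitLabel.not_isInput_mul,
    Fold.foldCircuit_isSymmetric hC, Fold.foldCircuit_eval_output_mul,
    le_of_eq (by rw [Fintype.card_sum, Fintype.card_unit])⟩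

end LabelledArithCircuit

end Literature.Computability.AlgebraicComplexity

end
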